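import Summits.CriticalPhenomena.CardyFormulaZ2.Theorems.CardyBoundaryCoulombGasRectilinearCardyStubRowBlocksPart3
import Summits.CriticalPhenomena.CardyFormulaZ2.Theorems.CardyBoundaryCoulombGasRectilinearCardyStubRowBlocksPart5
import Summits.CriticalPhenomena.CardyFormulaZ2.Theorems.CardyBoundaryCoulombGasRectilinearCardyStubRowBlocksPart6
import HarnessLib

/-!
# Stub B `stub_rowBlocks` of line `excursion-kernel-covariance`, part 7: the closest-arc rule inside
# the zone of a mark, read along the boundary cycle
# (crux `RectilinearCardy`, stmt-CriticalPhenomena-5660, route `CardyBoundaryCoulombGas`)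

The end-zone analysis of the ROW BLOCKS stub at a flat MARK `c = ∂D(tZ)` which is an end of the arc
`A` (left end: `σ = 1`, right end: `σ = -1`; inside `B(c, r)` the arc is the tangential half-line
`{σ sT (tngC z - tngC c) ≥ 0}`, `sT` the sign of the tangential coordinate of the loop near `tZ`):

* `rb_anchor_coord` — the integer tangential coordinate `kZ = τ ⌈τ q/δ⌉` of the first (`τ = σ s`) row
  vertex on the arc side of `c`: `0 ≤ τ (δ kZ - q) < δ`;
* `rb_near_param_of_flat` — frontier points close to a flat point `∂D(tZ)` are `∂D(t)` with
  `|t - tZ| ≤ θ` (intermediate values of the monotone tangential coordinate);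
* `rb_zone_mark_result` — **along the cycle, the attribution to `A` switches exactly once in the
  zone**: there is an anchor index `iZ` (a row dart within `2δ` of `c`, foot within `ε₂` of `tZ`) such
  that every dart whose lifted foot is within `2θ'` of `tZ` is a row dart, attributed to `A` iff
  `σ (i - iZ) ≥ 0`; moreover the walk's tangential sign IS `sT` (`rb_direction`). Ingredients: the run
  through the zone (`rb_zone_mark`), localisation of feet by the tube lemma (`rb_foot_window`) and by
  uniform continuity, and the closest-arc rule on the straight side (`rb_zone_criterion`).

All [folklore].
-/

noncomputable section

open Set Metric
open Literature.Probability.RandomPlanarGeometry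
open Literature.Probability.LatticeModels (Site meshPoint Orient)
open Literature.Probability.LatticeModels.CollarLegModel (Dart dartTip dir dsucc outDart period neighbours)

namespace Summit.CriticalPhenomena.CardyFormulaZ2.Cruxes.RectilinearCardy.ExcursionKernelCovariance

/-! ### The anchor coordinate -/

/-- **The first row coordinate on one side of a point**: for a sign `τ` and `δ > 0`, the integer
`kZ = τ ⌈τ q / δ⌉` satisfies `0 ≤ τ (δ kZ - q) < δ`. [folklore] -/
theorem rb_anchor_coord {δ q : ℝ} (hδ : 0 < δ) {τ : ℤ} (hτ : τ = 1 ∨ τ = -1) :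
    0 ≤ (τ : ℝ) * (δ * ((τ * ⌈(τ : ℝ) * q / δ⌉ : ℤ) : ℝ) - q) ∧
      (τ : ℝ) * (δ * ((τ * ⌈(τ : ℝ) * q / δ⌉ : ℤ) : ℝ) - q) < δ := by
  obtain ⟨h1, h2⟩ := kwl_ceil_bounds (h := (τ : ℝ) * q) hδ
  have hτ2 : (τ : ℝ) * τ = 1 := by rcases hτ with rfl | rfl <;> norm_num
  have key : (τ : ℝ) * (δ * ((τ * ⌈(τ : ℝ) * q / δ⌉ : ℤ) : ℝ) - q) = δ * (⌈(τ : ℝ) * q / δ⌉ : ℝ) - τ * q := by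
    push_cast
    linear_combination (δ * (⌈(τ : ℝ) * q / δ⌉ : ℝ)) * hτ2
  rw [key]
  constructor <;> linarith

/-! ### Parameters of frontier points near a flat point -/

/-- **Frontier points close to a flat point have close parameters.** Let the loop map `|t - tZ| ≤ θ`
into a ball about `c = ∂D(tZ)` on which `D̄ = {nrmC o ≥ h}`, `D = {nrmC o > h}`, let the tangential
coordinate `T` of the loop be strictly monotone with sign `sT` there, and let
`r₁ ≤ |T(tZ ± θ) - T(tZ)|`, `r₁ ≤ r`. Then every frontier point within `r₁` of `c` is `∂D(t)` for some
`|t - tZ| ≤ θ` (it lies on the line, and its tangential coordinate is an intermediate value of `T` on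
`[tZ - θ, tZ]` or `[tZ, tZ + θ]`). [folklore] -/
theorem rb_near_param_of_flat (D : JordanDomain) {o : Orient} {h r r₁ tZ θ sT : ℝ} (hθ : 0 ≤ θ)
    (hcl : ∀ z, dist z (D.boundary tZ) < r → (z ∈ closure D.carrier ↔ h ≤ Orient.nrmC o z))
    (hop : ∀ z, dist z (D.boundary tZ) < r → (z ∈ D.carrier ↔ h < Orient.nrmC o z))
    (hnear : ∀ t, |t - tZ| ≤ θ → dist (D.boundary t) (D.boundary tZ) < r)
    (hsT : sT = 1 ∨ sT = -1)
    (hT : ∀ t t' : ℝ, |t - tZ| ≤ θ → |t' - tZ| ≤ θ → t < t' →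
      0 < sT * (Orient.tngC o (D.boundary t') - Orient.tngC o (D.boundary t)))
    (hr₁ : r₁ ≤ |Orient.tngC o (D.boundary (tZ + θ)) - Orient.tngC o (D.boundary tZ)| ∧
      r₁ ≤ |Orient.tngC o (D.boundary (tZ - θ)) - Orient.tngC o (D.boundary tZ)|) (hr₁r : r₁ ≤ r) :
    ∀ z ∈ frontier D.carrier, dist z (D.boundary tZ) < r₁ → ∃ t, |t - tZ| ≤ θ ∧ D.boundary t = z := by
  set T : ℝ → ℝ := fun t => Orient.tngC o (D.boundary t) with hTdef
  intro z hz hzd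
  have hzn : Orient.nrmC o z = h := (rb_mem_frontier_iff_nrmC D.isOpen hcl hop (lt_of_lt_of_le hzd hr₁r)).1 hz
  have hline : ∀ t, |t - tZ| ≤ θ → Orient.nrmC o (D.boundary t) = h := fun t ht =>
    (rb_mem_frontier_iff_nrmC D.isOpen hcl hop (hnear t ht)).1 (D.boundary_mem_frontier t)
  set w : ℝ := Orient.tngC o z with hw
  have hwc : |w - T tZ| < r₁ := by
    rw [hw, hTdef]
    calc |Orient.tngC o z - Orient.tngC o (D.boundary tZ)| ≤ ‖z - D.boundary tZ‖ := by
          rw [← Orient.tngC_sub]; exact Orient.abs_tngC_le_norm o _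
      _ = dist z (D.boundary tZ) := (dist_eq_norm _ _).symm
      _ < r₁ := hzd
  have hcont : Continuous T := (kwl_continuous_tngC o).comp D.continuous_boundary
  have h0 : |tZ - tZ| ≤ θ := by simpa using hθ
  have hp : |tZ + θ - tZ| ≤ θ := by rw [add_sub_cancel_left, abs_of_nonneg hθ]
  have hm : |tZ - θ - tZ| ≤ θ := by rw [sub_sub_cancel_left, abs_neg, abs_of_nonneg hθ]
  -- an interval of parameters on which `w` is an intermediate value of `T`
  have hex : ∃ a, |a - tZ| ≤ θ ∧ w ∈ uIcc (T tZ) (T a) := by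
    rw [abs_lt] at hwc
    by_cases hsw : 0 ≤ sT * (w - T tZ)
    · refine ⟨tZ + θ, hp, ?_⟩
      have h1 := hr₁.1
      rcases hθ.lt_or_eq with hθ' | hθ'
      · have h2 := hT tZ (tZ + θ) h0 hp (by linarith)
        rw [mem_uIcc]
        rcases hsT with rfl | rfl
        · left
          rw [abs_of_pos (by linarith)] at h1
          constructor <;> nlinarith
        · right
          rw [abs_of_neg (by linarith)] at h1
          constructor <;> nlinarith
      · rw [← hθ', add_zero]
        have : w = T tZ := by
          rw [← hθ', add_zero, sub_self, abs_zero] at h1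
          linarith
        rw [this]; exact left_mem_uIcc
    · refine ⟨tZ - θ, hm, ?_⟩
      rw [not_le] at hsw
      have h1 := hr₁.2
      rcases hθ.lt_or_eq with hθ' | hθ'
      · have h2 := hT (tZ - θ) tZ hm h0 (by linarith)
        rw [mem_uIcc]
        rcases hsT with rfl | rfl
        · right
          rw [abs_of_neg (by linarith)] at h1
          constructor <;> nlinarith
        · left
          rw [abs_of_pos (by linarith)] at h1
          constructor <;> nlinarith
      · exfalso
        rw [← hθ', sub_zero, sub_self, abs_zero] at h1
        rcases hsT with rfl | rfl <;> nlinarith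
  obtain ⟨a, ha, hwmem⟩ := hex
  obtain ⟨t, ht, htw⟩ := intermediate_value_uIcc hcont.continuousOn hwmem
  have htθ : |t - tZ| ≤ θ := by
    rw [abs_le] at ha ⊢
    rcases mem_uIcc.1 ht with h' | h' <;> constructor <;> linarith [h'.1, h'.2]
  refine ⟨t, htθ, ?_⟩
  rw [kwl_eq_combo_of_nrmC (hline t htθ), kwl_eq_combo_of_nrmC hzn]
  simp only [hTdef] at htw
  rw [htw]

/-! ### The closest-arc rule inside the zone of a mark, along the cycle -/

/-- **Along the cycle, the attribution to the arc switches exactly once inside the zone of a mark.**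
See the module docstring. Setting: the lattice polygon `V = {x : δ x ∈ D̄}` with one enumeration `e`
of its exterior darts (period `P`) and lifted feet `F` (non-decreasing, `+1` per period, `η`-close),
normalised by `|F 0 - tX| < ε₂` with `tZ ∈ [tX + 2ε₂, tX + 1 - 2ε₂]`; a frame `(o, h)` on `B(∂D(tZ), r)`
with lattice frame `(k₀, s)`; the origin dart far from the mark; the tangential sign `sT` of the loop on
`|t - tZ| ≤ 2θ`; uniform continuity at scale `2θ'` (`ε₂ ≤ θ' ≤ θ`); the tube constant `m₂` of tolerance
`ε₂`; scales `3η ≤ N δ`, `(N + 4) δ ≤ rz`, `rz + η < m₂`, `rz ≤ r/8`, `40 δ ≤ r`; and the arc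
`A` described inside the ball as `{σ sT (tngC z - tngC c) ≥ 0}`. [folklore] -/
theorem rb_zone_mark_result (D : JordanDomain) {δ η r rz ε₂ m₂ θ θ' tX tZ sT h : ℝ}
    {V : Finset (ℤ × ℤ)} {e : ℕ → Dart} {F : ℕ → ℝ} {P N : ℕ} {o : Orient} {k₀ : Fin 4} {s σ : ℤ}
    {A : Set ℂ} (hδ : 0 < δ) (hη : 0 < η)
    (hV : ∀ x : ℤ × ℤ, x ∈ V ↔ meshPoint δ (![x.1, x.2] : Site 2) ∈ closure D.carrier)
    (hsucc : ∀ n, e (n + 1) = dsucc V (e n)) (hper : ∀ n, e (n + P) = e n)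
    (hext : ∀ n, (e n).1 ∈ V ∧ dartTip (e n) ∉ V)
    (henum : ∀ d : Dart, d.1 ∈ V → dartTip d ∉ V → ∃ n, n < P ∧ e n = d)
    (hnodup : ∀ n m, n < P → m < P → e n = e m → n = m)
    (hFmono : ∀ n, F n ≤ F (n + 1)) (hFP : ∀ n, F (n + P) = F n + 1)
    (hFclose : ∀ n, dist (D.boundary (F n)) (meshPoint δ (![(e n).1.1, (e n).1.2] : Site 2)) ≤ η)
    (hF0 : |F 0 - tX| < ε₂) (htZ : tX + 2 * ε₂ ≤ tZ ∧ tZ ≤ tX + 1 - 2 * ε₂)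
    (hc : Orient.nrmC o (D.boundary tZ) = h)
    (hcl : ∀ z, dist z (D.boundary tZ) < r → (z ∈ closure D.carrier ↔ h ≤ Orient.nrmC o z))
    (hop : ∀ z, dist z (D.boundary tZ) < r → (z ∈ D.carrier ↔ h < Orient.nrmC o z))
    (htab : ∀ x : ℤ × ℤ,
      Orient.nrm o (![(x + dir k₀).1, (x + dir k₀).2] : Site 2) = Orient.nrm o (![x.1, x.2] : Site 2) - 1 ∧
      Orient.nrm o (![(x + dir (k₀ + 1)).1, (x + dir (k₀ + 1)).2] : Site 2) = Orient.nrm o (![x.1, x.2] : Site 2) ∧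
      Orient.nrm o (![(x + dir (k₀ + 2)).1, (x + dir (k₀ + 2)).2] : Site 2) = Orient.nrm o (![x.1, x.2] : Site 2) + 1 ∧
      Orient.nrm o (![(x + dir (k₀ + 3)).1, (x + dir (k₀ + 3)).2] : Site 2) = Orient.nrm o (![x.1, x.2] : Site 2) ∧
      Orient.tng o (![(x + dir (k₀ + 1)).1, (x + dir (k₀ + 1)).2] : Site 2) = Orient.tng o (![x.1, x.2] : Site 2) + s ∧
      Orient.tng o (![(x + dir (k₀ + 3)).1, (x + dir (k₀ + 3)).2] : Site 2) = Orient.tng o (![x.1, x.2] : Site 2) - s)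
    (hk₀ : ∀ (x : ℤ × ℤ) (k : Fin 4),
      Orient.nrm o (![x.1, x.2] : Site 2) - 1 ≤ Orient.nrm o (![(x + dir k).1, (x + dir k).2] : Site 2) ∧
      (Orient.nrm o (![(x + dir k).1, (x + dir k).2] : Site 2) = Orient.nrm o (![x.1, x.2] : Site 2) - 1 ↔ k = k₀))
    (hs : s = 1 ∨ s = -1) (hσ : σ = 1 ∨ σ = -1) (hsT : sT = 1 ∨ sT = -1) (hrδ : 40 * δ ≤ r)
    (hfar : r / 2 ≤ dist (meshPoint δ (![(e 0).1.1, (e 0).1.2] : Site 2)) (D.boundary tZ))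
    (hT : ∀ t t' : ℝ, |t - tZ| ≤ 2 * θ → |t' - tZ| ≤ 2 * θ → t < t' →
      0 < sT * (Orient.tngC o (D.boundary t') - Orient.tngC o (D.boundary t)))
    (hθ : ε₂ ≤ θ' ∧ θ' ≤ θ)
    (hunif : ∀ s t : ℝ, |s - t| ≤ 2 * θ' → dist (D.boundary s) (D.boundary t) < r / 16)
    (htube : ∀ s t : ℝ, (∀ n : ℤ, ε₂ ≤ |s - t - n|) → m₂ ≤ dist (D.boundary s) (D.boundary t))
    (hrz : rz + η < m₂) (hN1 : 3 * η ≤ N * δ) (hN2 : (N + 4) * δ ≤ rz) (hrzr : rz ≤ r / 8)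
    (hAf : A ⊆ frontier D.carrier) (hAne : A.Nonempty) (hCne : (frontier D.carrier \ A).Nonempty)
    (hAend : ∀ z ∈ frontier D.carrier, dist z (D.boundary tZ) < r →
      (z ∈ A ↔ 0 ≤ σ * sT * (Orient.tngC o z - Orient.tngC o (D.boundary tZ)))) :
    ∃ iZ : ℕ, 3 < iZ ∧ iZ + 3 < P ∧ |F iZ - tZ| < ε₂ ∧ (e iZ).2 = k₀ ∧
      Orient.nrm o (![(e iZ).1.1, (e iZ).1.2] : Site 2) = ⌈h / δ⌉ ∧
      dist (meshPoint δ (![(e iZ).1.1, (e iZ).1.2] : Site 2)) (D.boundary tZ) < 2 * δ ∧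
      ((neighbours (e iZ).1).filter (fun y ↦ y ∉ V)).card = 1 ∧ (s : ℝ) = sT ∧
      ∀ i < P, |F i - tZ| < 2 * θ' →
        ((neighbours (e i).1).filter (fun y ↦ y ∉ V)).card = 1 ∧ (e i).2 = k₀ ∧
        Orient.nrm o (![(e i).1.1, (e i).1.2] : Site 2) = ⌈h / δ⌉ ∧
        (infDist (meshPoint δ (![(e i).1.1, (e i).1.2] : Site 2)) A ≤
            infDist (meshPoint δ (![(e i).1.1, (e i).1.2] : Site 2)) (frontier D.carrier \ A) ↔
          0 ≤ σ * ((i : ℤ) - iZ)) := by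
  set τ : ℤ := σ * s with hτ
  have hτ1 : τ = 1 ∨ τ = -1 := by rcases hσ with rfl | rfl <;> rcases hs with rfl | rfl <;> simp [hτ]
  have hε₂ : 0 < ε₂ := lt_of_le_of_lt (abs_nonneg _) hF0
  have hr : 0 < r := by linarith
  have hmono : Monotone F := monotone_nat_of_le_succ hFmono
  obtain ⟨hm1, hm2⟩ := kwl_ceil_bounds (h := h) hδ
  -- the anchor coordinate
  set kZ : ℤ := τ * ⌈(τ : ℝ) * Orient.tngC o (D.boundary tZ) / δ⌉ with hkZ
  obtain ⟨hq0, hq1⟩ := rb_anchor_coord (q := Orient.tngC o (D.boundary tZ)) hδ hτ1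
  have hτabs : |(τ : ℝ)| = 1 := by rcases hτ1 with h1 | h1 <;> simp [h1]
  have hkZ' : |δ * (kZ : ℝ) - Orient.tngC o (D.boundary tZ)| < δ := by
    have : |δ * (kZ : ℝ) - Orient.tngC o (D.boundary tZ)| =
        |(τ : ℝ) * (δ * (kZ : ℝ) - Orient.tngC o (D.boundary tZ))| := by rw [abs_mul, hτabs, one_mul]
    rw [this, abs_of_nonneg hq0]; exact hq1
  -- the run through the zone
  obtain ⟨xZ, iZ, hxt, hxn, hxdist, hiZ, hniZ, hiZn, hfwd, hcap⟩ :=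
    rb_zone_mark hδ hV hsucc hper hext henum hnodup hc hcl htab hk₀ hs hrδ hfar hkZ'
  have hiZP : iZ < P := by omega
  -- localisation of feet by the tube lemma
  have hloc : ∀ i ≤ P, dist (meshPoint δ (![(e i).1.1, (e i).1.2] : Site 2)) (D.boundary tZ) < rz →
      |F i - tZ| < ε₂ := by
    intro i hi hd
    obtain ⟨k, hk⟩ := rb_foot_window D htube (hFclose i) hd.le (by linarith)
    have h0 : F 0 ≤ F i := hmono (Nat.zero_le i)
    have h1 : F i ≤ F 0 + 1 := by
      have := hFP 0
      rw [zero_add] at this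
      rw [← this]; exact hmono hi
    have hF0' := hF0
    rw [abs_lt] at hF0' hk ⊢
    have hk3 : k ≤ -1 ∨ k = 0 ∨ 1 ≤ k := by omega
    rcases hk3 with hk' | hk' | hk'
    · have : (k : ℝ) ≤ -1 := by exact_mod_cast hk'
      exfalso; linarith [htZ.1]
    · rw [hk', Int.cast_zero, sub_zero] at hk; exact hk
    · have : (1 : ℝ) ≤ k := by exact_mod_cast hk'
      exfalso; linarith [htZ.2]
  have hFiZ : |F iZ - tZ| < ε₂ := hloc iZ hiZP.le (by rw [hiZ]; linarith)
  -- the direction of the walk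
  have hNn : N ≤ ⌊r / (4 * δ)⌋₊ + 3 := by
    have h1 : (N : ℝ) * δ ≤ r / 8 := by nlinarith
    have h2 : (N : ℝ) ≤ r / (4 * δ) := by rw [le_div_iff₀ (by positivity)]; nlinarith
    have h3 := Nat.lt_floor_add_one (r / (4 * δ))
    have h4 : (N : ℝ) < ((⌊r / (4 * δ)⌋₊ + 3 : ℕ) : ℝ) := by push_cast; linarith
    exact_mod_cast h4.le
  have heN : e (iZ + N) = (xZ + N • dir (k₀ + 1), k₀) := hfwd N hNn
  have htngN : Orient.tng o (![(e (iZ + N)).1.1, (e (iZ + N)).1.2] : Site 2) =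
      Orient.tng o (![(e iZ).1.1, (e iZ).1.2] : Site 2) + N * s := by
    rw [heN, hiZ, rb_nsmul_eq_zsmul, (rb_zsmul_coords htab xZ _).2]
  have hdN : dist (meshPoint δ (![(e (iZ + N)).1.1, (e (iZ + N)).1.2] : Site 2)) (D.boundary tZ) < rz := by
    rw [heN]
    have h1 := rb_dist_mesh_nsmul_le hδ xZ (k₀ + 1) N
    have h2 := dist_triangle (meshPoint δ (![(xZ + N • dir (k₀ + 1)).1, (xZ + N • dir (k₀ + 1)).2] : Site 2))
      (meshPoint δ (![xZ.1, xZ.2] : Site 2)) (D.boundary tZ)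
    nlinarith
  have hFN : |F (iZ + N) - tZ| < ε₂ := hloc (iZ + N) (by omega) hdN
  have hdir : (s : ℝ) = sT :=
    rb_direction D hδ hη hFmono hFclose hs hsT hT (by linarith [hFiZ.le]) (by linarith [hFN.le]) htngN hN1
  -- the anchor is a row dart
  have hiZrow : ((neighbours (e iZ).1).filter (fun y ↦ y ∉ V)).card = 1 := by
    rw [hiZ]; exact (rb_row_vertex hV hδ hcl hk₀ (by linarith) hxn).2.2.2.1
  refine ⟨iZ, hniZ.trans_le' (by omega), by omega, hFiZ, by rw [hiZ], by rw [hiZ]; exact hxn,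
    by rw [hiZ]; exact hxdist, hiZrow, hdir, fun i hi hFi => ?_⟩
  -- a dart with foot in the zone window is captured
  have hdi : dist (meshPoint δ (![(e i).1.1, (e i).1.2] : Site 2)) (D.boundary tZ) < r / 4 := by
    have h1 : dist (D.boundary (F i)) (D.boundary tZ) < r / 16 := hunif (F i) tZ hFi.le
    have h2 := dist_triangle (meshPoint δ (![(e i).1.1, (e i).1.2] : Site 2)) (D.boundary (F i)) (D.boundary tZ)
    have h3 : dist (meshPoint δ (![(e i).1.1, (e i).1.2] : Site 2)) (D.boundary (F i)) ≤ η := by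
      rw [dist_comm]; exact hFclose i
    linarith
  obtain ⟨hrow, hdr, hcard, j, hjn, hij, htng⟩ := hcap i hi hdi
  refine ⟨hcard, hdr, hrow, ?_⟩
  -- the closest-arc rule at the captured dart
  have hστ : (σ : ℝ) * sT = τ := by rw [← hdir, hτ]; push_cast; ring
  have hsσ : (σ : ℝ) * sT = 1 ∨ (σ : ℝ) * sT = -1 := by
    rw [hστ]; rcases hτ1 with h1 | h1 <;> simp [h1]
  have hp0 : h ≤ Orient.nrmC o (meshPoint δ (![(e i).1.1, (e i).1.2] : Site 2)) :=
    (hcl _ (by linarith)).1 ((hV _).1 (hext i).1)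
  have hp1 : Orient.nrmC o (meshPoint δ (![(e i).1.1, (e i).1.2] : Site 2)) - h < r / 4 := by
    rw [Orient.nrmC_meshPoint, hrow]; linarith
  obtain ⟨hcrit1, hcrit2⟩ := rb_zone_criterion (A := A) (s := (σ : ℝ) * sT)
    (p := meshPoint δ (![(e i).1.1, (e i).1.2] : Site 2)) D.isOpen hcl hop hAf hAne hCne hsσ hAend hdi hp0 hp1
  -- the deciding quantity
  have hs2 : (s : ℝ) * s = 1 := by rcases hs with rfl | rfl <;> norm_num
  have hQ : (σ : ℝ) * sT * (Orient.tngC o (meshPoint δ (![(e i).1.1, (e i).1.2] : Site 2)) -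
      Orient.tngC o (D.boundary tZ)) =
      (τ : ℝ) * (δ * (kZ : ℝ) - Orient.tngC o (D.boundary tZ)) + σ * δ * j := by
    rw [Orient.tngC_meshPoint, htng, ← hdir, hτ]; push_cast; linear_combination (σ : ℝ) * δ * j * hs2
  rw [hQ] at hcrit1 hcrit2
  have hjσ : (i : ℤ) - iZ = j := by omega
  rw [hjσ]
  have h6 : (σ : ℝ) * δ * j = δ * (σ * j) := by ring
  constructor
  · intro hattr
    by_contra hneg
    rw [not_le] at hneg
    have hneg' : (σ : ℝ) * j ≤ -1 := by
      have : σ * j ≤ -1 := by omega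
      exact_mod_cast this
    have h5 : δ * ((σ : ℝ) * j) ≤ δ * (-1) := mul_le_mul_of_nonneg_left hneg' hδ.le
    have h7 : (τ : ℝ) * (δ * (kZ : ℝ) - Orient.tngC o (D.boundary tZ)) + σ * δ * j < 0 := by linarith
    have h8 := hcrit2 h7
    exact absurd hattr (not_le.2 h8)
  · intro hpos
    have hpos' : (0 : ℝ) ≤ σ * j := by exact_mod_cast hpos
    have h5 : 0 ≤ δ * ((σ : ℝ) * j) := mul_nonneg hδ.le hpos'
    have h7 : 0 ≤ (τ : ℝ) * (δ * (kZ : ℝ) - Orient.tngC o (D.boundary tZ)) + σ * δ * j := by linarith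
    exact hcrit1 h7

end Summit.CriticalPhenomena.CardyFormulaZ2.Cruxes.RectilinearCardy.ExcursionKernelCovariance

end
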